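import Summits.Parity.GeneralizedHardyLittlewood.Theorems.PrimeLevelFamEdgeMomentsBeyondDiagonalDiagRemOneThreeBose
import HarnessLib

/-!
# Route `PrimeLevelFamEdge`, crux K_A `MomentsBeyondDiagonal` (stmt-Parity-20007), line «petersson_layers» v4, stub `stub_diag`:
# **the continued Bose remainder `r₀₄` of ORDER `(0,4)` in `Π`-form and the five kernels of (R₀₄) under one set of constants**
# (bricks B2 + B4b of the order-`(0,4)` remainder estimate (R₀₄))

The order-`(0,4)` piece of `stub_diag` (first order of rung `N = 4`) is reduced to the single remainder estimate (R₀₄) by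
`…DiagDecorOrderZeroFourTarget.orderZeroFour_target_of_remainder` (lineage famedge-2 g6, (Poly₀₄) unconditional). (R₀₄) carries the
FIVE kernels `r₀₀, r₀₁, r₀₂, r₀₃, r₀₄`; the first four are in the tree in `Π`-form under one constant (`…DiagRemOneThreeBose.twoSeq_eight₁₃`).
This file adds `r₀₄` in exactly the `Π`-form printed in the hypothesis `hR` of the order-`(0,4)` target and bundles the five:

* `abs_doubleSum_rem_le₀₄b` — **`Π₀₄ = L⁵/160 + μ₂L³ + 2μ₄L + E₀₄`** (`μ_m = ∫₀¹logᵐv·v/(1+v²)²`, `μ₀ = 1/4`; from the generic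
  `…DiagRemBoseTwoSeq.abs_doubleSum_bose_rem_le₂ 0 4`, the odd moments cancel), two-sequence Abel estimate with the common envelope
  `9C₀(1+|log 2αY²|)⁶`;
* `twoSeq_five₀₄` — **the five remainder kernels of order `(0,4)` under one set of constants `C₀, C_P`, plus the both-sided
  `P₂ ⊗ P₂ · r₀₀` monomial** (the order-`(0,4)` twin of `twoSeq_eight₁₃` / `…DiagRemTwoTwoEnvelopes.twoSeq_nine₂₂`).

Def-free; theorems only. Helper `--supports stmt-Parity-20007`; closes nothing (bricks B3–B5 of (R₀₄), the orders `(2,4)`, `(4,4)` and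
`stub_rung/core/band/farP` remain); K_A, K_B and the Parity summit are NOT proved; nothing about Landau–Siegel zeros.

## References
* E. Kowalski, P. Michel, J. VanderKam, J. reine angew. Math. 526 (2000), (22)–(28) pp. 12–15 and Prop. 5.1 p. 18.
  [cite: KowalskiMichelVanderKam2000, (22)–(28) and Prop. 5.1 — derivation (corner of the diagonal, general Q, order (0,4))]
-/

noncomputable section

open scoped Real
open Finset Real MeasureTheory

namespace Summit.Parity.GeneralizedHardyLittlewood.Theorems.MomentsBeyondDiagonal.DiagCorner

open Summit.Parity.GeneralizedHardyLittlewood.Theorems.BeyondDiagonalBeatsQuarter.KernelFormXSq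
  (copTauW divWeight divWeight_nonneg)
open Summit.Parity.GeneralizedHardyLittlewood.Theorems.BeyondDiagonalBeatsQuarter.Corner
open Summit.Parity.GeneralizedHardyLittlewood.Theorems.MomentsBeyondDiagonal.DiagLines

set_option maxHeartbeats 800000 in
-- one large kernel statement
/-- **THE CONTINUED BOSE REMAINDER `r₀₄` IN `Π`-FORM (moments `μ₂, μ₄` explicit), TWO-SEQUENCE ABEL ESTIMATE WITH THE COMMON
ENVELOPE `9C₀(1+|log 2αY²|)⁶`.** [cite: KowalskiMichelVanderKam2000, (22)–(28) and Prop. 5.1 — derivation (corner of the diagonal, general Q, order (0,4))] -/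
theorem abs_doubleSum_rem_le₀₄b : ∃ E₀₄ C₀ : ℝ, 0 ≤ C₀ ∧
    ∀ (a₁ a₂ : ℕ → ℝ) (Y α B η : ℝ) (K₁ i j : ℕ), 1 ≤ Y → 0 < α → 1 ≤ i → 1 ≤ j →
      (∀ e : ℕ, e ≤ ⌊Y⌋₊ → |∑ k ∈ Icc 1 e, a₂ k| ≤ B) → (∀ e : ℕ, K₁ ≤ e → |∑ k ∈ Icc 1 e, a₁ k| ≤ η) →
      2 * α * K₁ * Y ≤ 1 →
    |∑ k₁ ∈ Icc 1 ⌊Y⌋₊, ∑ k₂ ∈ Icc 1 ⌊Y⌋₊,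
        a₁ k₁ * a₂ k₂ * ellp Y k₁ ^ i * ellp Y k₂ ^ j *
          ((∫ u₁ in Set.Ioi (0 : ℝ), ∫ u₂ in Set.Ioi ((α * k₁ * k₂) / u₁),
              Real.exp (-(u₁ + u₂)) / (1 - Real.exp (-(u₁ + u₂))) ^ 2 * Real.log u₂ ^ 4) -
            (Real.log (1 / (α * k₁ * k₂)) ^ 5 / 160 + (∫ v in Set.Ioc (0 : ℝ) 1, Real.log v ^ 2 * (v / (1 + v ^ 2) ^ 2)) * Real.log (1 / (α * k₁ * k₂)) ^ 3 + 2 * (∫ v in Set.Ioc (0 : ℝ) 1, Real.log v ^ 4 * (v / (1 + v ^ 2) ^ 2)) * Real.log (1 / (α * k₁ * k₂)) + E₀₄))| ≤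
      (∑ k ∈ Icc 1 ⌊Y⌋₊, |a₁ k| * ellp Y k ^ i) * (B * (Real.log Y ^ j * (3 * C₀ * Real.sqrt (2 * α * K₁ * Y)))) +
          (∑ k ∈ Icc 1 ⌊Y⌋₊, |a₂ k| * ellp Y k ^ j) *
            ((2 * η) * (Real.log Y ^ i * (9 * C₀ * (1 + |Real.log (2 * α * Y ^ 2)|) ^ 6))) := by
  obtain ⟨C₀, hC₀0, h₀₄⟩ := abs_doubleSum_bose_rem_le₂ 0 4
  refine ⟨((∫ u₁ in Set.Ioi (0 : ℝ), Real.log u₁ ^ 0 * ∫ u₂ in Set.Ioi (1 / u₁),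
        Real.exp (-(u₁ + u₂)) / (1 - Real.exp (-(u₁ + u₂))) ^ 2 * Real.log u₂ ^ 4) +
      (∫ η in Set.Ioc (0 : ℝ) 1, (η * (∫ u in Set.Ioi (0 : ℝ), Real.log u ^ 0 * Real.log (η / u) ^ 4 *
            (Real.exp (-(u + η / u)) / (1 - Real.exp (-(u + η / u))) ^ 2) / u) -
          ∫ v in Set.Ioc (0 : ℝ) 1, ((-(Real.log (1 / η) / 2) + Real.log v) ^ 0 * (-(Real.log (1 / η) / 2) - Real.log v) ^ 4 +
              (-(Real.log (1 / η) / 2) - Real.log v) ^ 0 * (-(Real.log (1 / η) / 2) + Real.log v) ^ 4) *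
            (v / (1 + v ^ 2) ^ 2)) / η)),
    C₀, hC₀0, fun a₁ a₂ Y α B η K₁ i j hY hα hi hj hB hη hY₁ ↦ ?_⟩
  have hY0 : 0 < Y := by linarith
  have hη0 : 0 ≤ η := (abs_nonneg _).trans (hη K₁ le_rfl)
  have hLY : 0 ≤ Real.log Y := Real.log_nonneg hY
  have hx : (1 : ℝ) ≤ 1 + |Real.log (2 * α * Y ^ 2)| := by linarith [abs_nonneg (Real.log (2 * α * Y ^ 2))]
  have hSj : 0 ≤ ∑ k ∈ Icc 1 ⌊Y⌋₊, |a₂ k| * ellp Y k ^ j :=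
    Finset.sum_nonneg fun k _ ↦ mul_nonneg (abs_nonneg _) (pow_nonneg (ellp_nonneg Y k) j)
  have hc42 : Nat.choose 4 2 = 6 := by decide
  have hc43 : Nat.choose 4 3 = 4 := by decide
  have h := h₀₄ a₁ a₂ Y α B η K₁ i j hY hα hi hj hB hη hY₁
  have h'' := weaken_second_term6 hSj hη0 hLY hC₀0 hx (by norm_num : 0 + 4 + 1 ≤ 5) h
  refine le_trans (le_of_eq ?_) h''
  congr 1
  refine Finset.sum_congr rfl fun k₁ _ ↦ Finset.sum_congr rfl fun k₂ _ ↦ ?_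
  simp only [Finset.sum_range_succ, Finset.sum_range_zero, zero_add, add_zero, Nat.choose_self,
    Nat.choose_zero_right, Nat.choose_one_right, hc42, hc43, Nat.cast_one, Nat.cast_ofNat, Nat.sub_self, Nat.sub_zero,
    Nat.reduceSub, Nat.reduceAdd, Nat.cast_zero, Nat.cast_add, pow_zero, pow_one, one_mul, mul_one,
    integral_model_weight_Ioc]
  ring

set_option maxHeartbeats 1600000 in
-- five kernels, large statement
/-- **The five remainder kernels of order `(0,4)` under one set of constants, plus the both-sided monomial** (module docstring;
the order-`(0,4)` twin of `…DiagRemOneThreeBose.twoSeq_eight₁₃`).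
[cite: KowalskiMichelVanderKam2000, (23)–(28) and Prop. 5.1 — derivation (order-(0,4) remainder, inner sums)] -/
theorem twoSeq_five₀₄ : ∃ E₀₀ E₀₁ E₀₂ E₀₃ E₀₄ C₀ C_P : ℝ, 0 ≤ C₀ ∧ 0 ≤ C_P ∧
    (∀ R : ℝ → ℝ,
      (R = (fun y : ℝ ↦ ((∫ u₁ in Set.Ioi (0 : ℝ), ∫ u₂ in Set.Ioi (y / u₁),
              Real.exp (-(u₁ + u₂)) / (1 - Real.exp (-(u₁ + u₂))) ^ 2) -
            (Real.log (1 / y) / 2 + E₀₀))) ∨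
       R = (fun y : ℝ ↦ ((∫ u₁ in Set.Ioi (0 : ℝ), ∫ u₂ in Set.Ioi (y / u₁),
              Real.exp (-(u₁ + u₂)) / (1 - Real.exp (-(u₁ + u₂))) ^ 2 * Real.log u₂) -
            (-(Real.log (1 / y) ^ 2) / 8 + E₀₁))) ∨
       R = (fun y : ℝ ↦ ((∫ u₁ in Set.Ioi (0 : ℝ), ∫ u₂ in Set.Ioi (y / u₁),
              Real.exp (-(u₁ + u₂)) / (1 - Real.exp (-(u₁ + u₂))) ^ 2 * Real.log u₂ ^ 2) -
            (Real.log (1 / y) ^ 3 / 24 + 2 * (∫ v in Set.Ioc (0 : ℝ) 1, Real.log v ^ 2 * (v / (1 + v ^ 2) ^ 2)) * Real.log (1 / y) + E₀₂))) ∨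
       R = (fun y : ℝ ↦ ((∫ u₁ in Set.Ioi (0 : ℝ), ∫ u₂ in Set.Ioi (y / u₁),
              Real.exp (-(u₁ + u₂)) / (1 - Real.exp (-(u₁ + u₂))) ^ 2 * Real.log u₂ ^ 3) -
            (-(Real.log (1 / y) ^ 4) / 64 - 3 * (∫ v in Set.Ioc (0 : ℝ) 1, Real.log v ^ 2 * (v / (1 + v ^ 2) ^ 2)) / 2 * Real.log (1 / y) ^ 2 + E₀₃))) ∨
       R = (fun y : ℝ ↦ ((∫ u₁ in Set.Ioi (0 : ℝ), ∫ u₂ in Set.Ioi (y / u₁),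
              Real.exp (-(u₁ + u₂)) / (1 - Real.exp (-(u₁ + u₂))) ^ 2 * Real.log u₂ ^ 4) -
            (Real.log (1 / y) ^ 5 / 160 + (∫ v in Set.Ioc (0 : ℝ) 1, Real.log v ^ 2 * (v / (1 + v ^ 2) ^ 2)) * Real.log (1 / y) ^ 3 + 2 * (∫ v in Set.Ioc (0 : ℝ) 1, Real.log v ^ 4 * (v / (1 + v ^ 2) ^ 2)) * Real.log (1 / y) + E₀₄)))) →
      ∀ (a₁ a₂ : ℕ → ℝ) (Y α B η : ℝ) (K₁ i j : ℕ), 1 ≤ Y → 0 < α → 1 ≤ i → 1 ≤ j →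
        (∀ e : ℕ, e ≤ ⌊Y⌋₊ → |∑ k ∈ Icc 1 e, a₂ k| ≤ B) → (∀ e : ℕ, K₁ ≤ e → |∑ k ∈ Icc 1 e, a₁ k| ≤ η) →
        2 * α * K₁ * Y ≤ 1 →
      |∑ k₁ ∈ Icc 1 ⌊Y⌋₊, ∑ k₂ ∈ Icc 1 ⌊Y⌋₊,
          a₁ k₁ * a₂ k₂ * ellp Y k₁ ^ i * ellp Y k₂ ^ j * R (α * k₁ * k₂)| ≤
        (∑ k ∈ Icc 1 ⌊Y⌋₊, |a₁ k| * ellp Y k ^ i) * (B * (Real.log Y ^ j * (3 * C₀ * Real.sqrt (2 * α * K₁ * Y)))) +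
          (∑ k ∈ Icc 1 ⌊Y⌋₊, |a₂ k| * ellp Y k ^ j) *
            ((2 * η) * (Real.log Y ^ i * (9 * C₀ * (1 + |Real.log (2 * α * Y ^ 2)|) ^ 6)))) ∧
    (∀ n : ℕ, n ≠ 0 → ∀ (Y α : ℝ) (K₁ i j : ℕ), 1 ≤ Y → 0 < α → 1 ≤ i → 1 ≤ j → 2 * α * K₁ * Y ≤ 1 →
    |∑ k₁ ∈ Icc 1 ⌊Y⌋₊, ∑ k₂ ∈ Icc 1 ⌊Y⌋₊,
        (copTauW n k₁ * ∑ p ∈ k₁.primeFactors, Real.log p ^ 2) * (copTauW n k₂ * ∑ p ∈ k₂.primeFactors, Real.log p ^ 2) *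
          ellp Y k₁ ^ i * ellp Y k₂ ^ j * (fun y : ℝ ↦ ((∫ u₁ in Set.Ioi (0 : ℝ), ∫ u₂ in Set.Ioi (y / u₁),
              Real.exp (-(u₁ + u₂)) / (1 - Real.exp (-(u₁ + u₂))) ^ 2) -
            (Real.log (1 / y) / 2 + E₀₀))) (α * k₁ * k₂)| ≤
      Real.log Y ^ (i + j) * (C₀ *
        ((3 * ((1 + Real.log Y) ^ 4 + C_P * divWeight n) * (1 + Real.log Y) ^ 4 +
            3 * (C_P * divWeight n) * ((1 + Real.log Y) ^ 4 + C_P * divWeight n) + (C_P * divWeight n) ^ 2) *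
            Real.sqrt (2 * α * K₁ * Y) +
          (18 * (1 + Real.log Y) ^ 4 * (C_P * divWeight n) + 19 * (C_P * divWeight n) ^ 2) *
            (1 + |Real.log (2 * α * Y ^ 2)|) ^ 6 / (1 + Real.log K₁) ^ 12))) := by
  obtain ⟨E₀₀, E₀₁, E₁₀, E₀₂, E₁₁, E₁₂, E₀₃, E₁₃, C₀a, C_P, hC₀a, hC_P, hA, hBS⟩ := twoSeq_eight₁₃
  obtain ⟨E₀₄, C₀c, hC₀c, hCc⟩ := abs_doubleSum_rem_le₀₄b
  set C₀ : ℝ := max C₀a C₀c with hC₀def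
  have ea : C₀a ≤ C₀ := le_max_left _ _
  have ec : C₀c ≤ C₀ := le_max_right _ _
  have hC₀ : 0 ≤ C₀ := hC₀a.trans ea
  refine ⟨E₀₀, E₀₁, E₀₂, E₀₃, E₀₄, C₀, C_P, hC₀, hC_P, ?_, ?_⟩
  · intro R hRR a₁ a₂ Y α B η K₁ i j hY hα hi hj hcol hrow hY₁
    have hLY0 : 0 ≤ Real.log Y := Real.log_nonneg hY
    have hB0 : 0 ≤ B := (abs_nonneg _).trans (hcol 0 (Nat.zero_le _))
    have hη0 : 0 ≤ η := (abs_nonneg _).trans (hrow K₁ le_rfl)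
    have hS₁ : 0 ≤ ∑ k ∈ Icc 1 ⌊Y⌋₊, |a₁ k| * ellp Y k ^ i :=
      Finset.sum_nonneg fun k _ ↦ mul_nonneg (abs_nonneg _) (pow_nonneg (ellp_nonneg Y k) i)
    have hS₂ : 0 ≤ ∑ k ∈ Icc 1 ⌊Y⌋₊, |a₂ k| * ellp Y k ^ j :=
      Finset.sum_nonneg fun k _ ↦ mul_nonneg (abs_nonneg _) (pow_nonneg (ellp_nonneg Y k) j)
    have hLi : 0 ≤ Real.log Y ^ i := pow_nonneg hLY0 i
    have hLj : 0 ≤ Real.log Y ^ j := pow_nonneg hLY0 j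
    have hs0 : 0 ≤ Real.sqrt (2 * α * K₁ * Y) := Real.sqrt_nonneg _
    have hx0 : 0 ≤ 1 + |Real.log (2 * α * Y ^ 2)| := by positivity
    rcases hRR with rfl | rfl | rfl | rfl | rfl
    · exact twoSeq_envelope_mono hS₁ hS₂ hB0 hη0 hLi hLj hs0 hx0 ea
        (hA _ (Or.inl rfl) a₁ a₂ Y α B η K₁ i j hY hα hi hj hcol hrow hY₁)
    · exact twoSeq_envelope_mono hS₁ hS₂ hB0 hη0 hLi hLj hs0 hx0 ea
        (hA _ (Or.inr (Or.inl rfl)) a₁ a₂ Y α B η K₁ i j hY hα hi hj hcol hrow hY₁)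
    · exact twoSeq_envelope_mono hS₁ hS₂ hB0 hη0 hLi hLj hs0 hx0 ea
        (hA _ (Or.inr (Or.inr (Or.inr (Or.inl rfl)))) a₁ a₂ Y α B η K₁ i j hY hα hi hj hcol hrow hY₁)
    · exact twoSeq_envelope_mono hS₁ hS₂ hB0 hη0 hLi hLj hs0 hx0 ea
        (hA _ (Or.inr (Or.inr (Or.inr (Or.inr (Or.inr (Or.inr (Or.inl rfl))))))) a₁ a₂ Y α B η K₁ i j hY hα hi hj hcol hrow hY₁)
    · exact twoSeq_envelope_mono hS₁ hS₂ hB0 hη0 hLi hLj hs0 hx0 ec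
        (hCc a₁ a₂ Y α B η K₁ i j hY hα hi hj hcol hrow hY₁)
  · intro n hn Y α K₁ i j hY hα hi hj hY₁
    refine (hBS n hn Y α K₁ i j hY hα hi hj hY₁).trans ?_
    have hLY0 : 0 ≤ Real.log Y := Real.log_nonneg hY
    have hD := divWeight_nonneg n
    have hbr : 0 ≤ (3 * ((1 + Real.log Y) ^ 4 + C_P * divWeight n) * (1 + Real.log Y) ^ 4 +
            3 * (C_P * divWeight n) * ((1 + Real.log Y) ^ 4 + C_P * divWeight n) + (C_P * divWeight n) ^ 2) *
            Real.sqrt (2 * α * K₁ * Y) +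
          (18 * (1 + Real.log Y) ^ 4 * (C_P * divWeight n) + 19 * (C_P * divWeight n) ^ 2) *
            (1 + |Real.log (2 * α * Y ^ 2)|) ^ 6 / (1 + Real.log K₁) ^ 12 := by
      have : 0 ≤ Real.log (K₁ : ℝ) := Real.log_natCast_nonneg K₁
      positivity
    exact mul_le_mul_of_nonneg_left (mul_le_mul_of_nonneg_right ea hbr) (pow_nonneg hLY0 _)

end Summit.Parity.GeneralizedHardyLittlewood.Theorems.MomentsBeyondDiagonal.DiagCorner

end
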